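import Summits.Schanuel.Schanuel.Theorems.RootDecomp1KLogLogCell01

/-!
# RootDecomp1KTwoBaseCell — lens 1, generation 36 «TWO-BASE WALL CELL of 33364» (RootDecomp1KTwoBaseCell.lean f6aad3c3…, 1847 l) — part 1 (RootDecomp1KTwoBaseCell01): §1 tails of Liouville numbers in base `m ≥ 2`; §2 monomial weights `wt b m = ∏ b_i^{m_i}`, injectivity for `(2, 3)` and pairwise-coprime bases

PORT NOTE (census-1 gen 15, 2026-08-31): port of HOME/decomp-schanuel-lens-1/g36/RootDecomp1KTwoBaseCell.lean (sha256 f6aad3c3…cd39, 1847 l; own farm rc 0 · 0 warn ·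
0 sorry · axioms std; critic VERDICT STATUS L1729: CHECKLIST K-g36 MET, ONE cell-decision credit (K-R22 (β): the wall (1, ℓ₂, ℓ₃) decided, and every injective-weight
multi-base wall) to lens-1 g36, RULE K-R23, PORT GO LOW census lane) in NINE parts `RootDecomp1KTwoBaseCell01`–`09`: 01 = §1 tails + §2 monomial weights, 02 = §3 the
LACUNARY NON-VANISHING LEMMA at the limit point, 03 = §4 tools, 04 = §4 ENGINE `algebraicIndependent_liouville_of_mvPolyMeasure`, 05 = §5 named forms / suppliers / Schanuel's
bound on the multi-base cells, 06 = §6 first half (`liouvilleNumber_sub_rat_lower_loglog`, …), 07 = §6 the two-scale form bound (`form_lower_bound_W`), 08 = §7 the cells against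
the LIVE item 33364, 09 = §7 the members `zW`, `zWpi`. Imports the TREE `RootDecomp1KLogLogCell01` (this seat's port of g35); `set_option linter.dupNamespace false`
dropped; 19 one-line docstrings added; eleven generic one-liners / tree twins (`remainder_*`, `mvlen_*'`, `finsupp_sum_eq_sum`, `linearIndependent_of_int_forms'`, …) made `private` with per-part copies; statements and proofs
verbatim; `hNW : NWMeasure` stays a binder BY NAME. `--supports stmt-Schanuel-33364`; no census credit. Nothing here proves Schanuel; rung 0. The lens's header follows.
-/

/-!
# RootDecomp1K — lens 1 (grading / quantitative ladder), gen 36: the «TWO-BASE WALL CELL» of item 33364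
# (`FiniteOrderLiouvilleSchanuel`, A₄ᵈ) — Schanuel's bound on `(1, ℓ₂, ℓ₃)` (mod the by-name fact `NWMeasure`) and
# on its π-twin `(π, πℓ₂, πℓ₃)` HYPOTHESIS-FREE; more generally on every MULTI-BASE cell `(1, ℓ_{b_1}, …, ℓ_{b_k})`
# whose bases have injective monomial weights `m ↦ ∏ b_i^{m_i}` (e.g. pairwise coprime), `ℓ_b = liouvilleNumber b`

Cell decomp-schanuel, seat `decomp-schanuel-lens-1`, gen 36 (2026-08-31); the K-R22 (β) credit reserved to lens 1
(STATUS L1698 VERDICT g35; claim L1704/L1705; ACK + CHECKLIST K-g36 L1706).  Route of record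
`route-Schanuel-RootDecomp1K` (DRAFT; `closes hL hH hF hB`), item **F** =
`Summit.Schanuel.Schanuel.Theses.RootDecomp1K.FiniteOrderLiouvilleSchanuel` (stmt-Schanuel-33364).  Nothing here
proves Schanuel; rung 0.  No 1K decl is restated: the item is consumed BY NAME in the probe file (`TBprobe.lean`).
Imports tree Theorems only (`…RootDecomp1KLogLogCell01` = g35 port part 1, for the class `LogLogLiouville` and its
ladder lemmas BY NAME; it re-exports Cell08 / Hyper / Generic).  The e-versions carry the tree's by-name fact
binder `(hNW : NWMeasure)` exactly as g34 / g35 / Hyper01 prescribe; the π-versions carry nothing.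

## What is new relative to g14 / g34 / g35 (K-R22 (β): «the wall (1, ℓ₂, ℓ₃)»)
Every previous engine (lens 6 g14, g34, g35; Hyper03 §10c) takes ONE Liouville coordinate `ℓ₂` next to a tuple
`θ⃗` WITH A MEASURE and decides the cells `(1, ℓ₂, ρ)` by the Diophantine GRADE of `ρ` over ℓ₂'s scales:
hyper ⊂ log-hyper ⊂ log-square ⊂ log-log.  `ℓ₃ = Σ 3^{−k!}` is BELOW that ladder
(`not_logLogLiouville_liouvilleNumber`: `|ℓ_b − p/q| ≥ exp(−8 · log q · loglog q)` for `q ≥ max(b, 100)`), so all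
of them are SILENT on the wall.  THE NEW ENGINE treats all `k` Liouville coordinates as specialisation variables at
the COMMON scale `M = (N+1)!`:
* §3 THE LACUNARY NON-VANISHING LEMMA — if the weights `m ↦ ∏ b_i^{m_i}` are injective (unique factorisation),
  EVERY non-zero `q ∈ ℝ[Y⃗]` (any degree, NO minimality, NO irreducibility) has `q(s_N) ≠ 0` for all large `N`,
  `s_{N,i} = partialSum (b i) N` (Taylor expansion at `ℓ⃗`: the increments `ℓ_{b_i} − s_{N,i} = b_i^{−M}(1 + o(1))`
  are multiplicatively independent, so the Taylor term of minimal weight is unique and dominates);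
* §4 THE EXTRACTION `MvPolyMeasure θ⃗ ⇒ AlgebraicIndependent ℚ (ℓ⃗, θ⃗)` (write `P = Σ_α Q_α(Y⃗) X^α`, pick
  `Q_α ≠ 0`, specialise `Y⃗ ↦ s_N` — non-zero by §3 — clear the denominators `∏ b_i^{N!·deg}`, compare θ⃗'s
  POLYNOMIAL-in-length measure `(C·lenᵗ)⁻¹`, `len ≤ B^{c·N!}`, with the Lipschitz error `≤ c'·2^{−(N+1)!}`:
  `(N+1)!` beats every fixed multiple of `N!`; a weak measure `exp(−(log len)^κ)`, `κ ≥ 2`, would NOT close —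
  control C2).
No window, no induced measure, no grade of a third datum: the wall cell itself, and every `k`.

## Content (sorry-free; axioms `propext, Classical.choice, Quot.sound`)
* §1 tails of `ℓ_m` (`remainder_le : r_k ≤ 2/m^{(k+1)!}`, `numerator_lt`); §2 weights `wt b m = ∏ b_i^{m_i}`,
  `wt_injective_of_pairwise_coprime`, the instance `b23 = (2, 3)` (`wt_b23_injective`).
* §3 `eventually_eval_partialSum_ne_zero (hb : ∀ i, 2 ≤ b i) (hinj : Injective (wt b)) (hq : q ≠ 0) :
  ∃ N₀, ∀ N ≥ N₀, eval (s_N) q ≠ 0`  (= **(L)** `lacunary_eval_ne_zero_eventually`, §5, raw `hinj`).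
* §4 `algebraicIndependent_liouville_of_mvPolyMeasure (hb) (hinj) (hθ : MvPolyMeasure θ) :
  AlgebraicIndependent ℚ (Sum.elim ℓ⃗ θ⃗)`  (= **(X)** `algebraicIndependent_lacunary_append`, `Fin.append` form, §5).
* §5 suppliers: `sb_multiBaseCell (hNW) (hb) (hinj) : SB (k+1) (Fin.cons 1 ℓ⃗)` (θ⃗ = (e), tree
  `polyMeasure_exp_one_of_NW hNW`), `sb_multiBaseCell_pi (hb) (hinj)` (θ⃗ = (π), tree `polyMeasure_pi`;
  HYPOTHESIS-FREE), `sb_twoBaseCell (hNW)`, `sb_twoBaseCell_pi`, `sb_threeBaseCell_pi` (bases (2,3,5), k = 3);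
  the control facts `wt_b24_not_injective` / `weights_b24_not_injective` (`2² = 4¹`).
* §6 hypothesis-free certificates: `liouvilleNumber_sub_rat_lower_loglog (2 ≤ b) (b ≤ r.den) (100 ≤ r.den) :
  exp(−8 · log r.den · loglog r.den) ≤ |ℓ_b − r|` (the truncations have EXACT denominator `b^{K!}`,
  `coprime_psNumer`), `not_logLogLiouville_liouvilleNumber (2 ≤ b)`; the TWO-SCALE FORM BOUND
  `form_lower_bound_W (g ≠ 0) : exp(−(1+Σ|gᵢ|)^11) ≤ |g₀ + g₁ℓ₂ + g₂ℓ₃|` (at one of two consecutive scales the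
  truncated form is a non-zero rational with denominator `6^{K!}` — else `2^{(N+1)!} ∣ g₁`, `form_two_scale`).
* §7 THE CELL THEOREMS with 33364's binders VERBATIM + ONE cell line after `LinearIndependent ℚ z`:
  `finiteOrderLiouvilleSchanuel_twoBaseCell (hNW)` (`Set.range z = Set.range ![1, ℓ₂, ℓ₃]`),
  `…_twoBaseCell_pi` (HYPOTHESIS-FREE), `…_multiBaseCell (hNW) (hb) (hinj)`
  (`Set.range z = Set.range (Fin.cons 1 (fun i => ℓ_{b i}))`), `…_multiBaseCell_pi (hb) (hinj)`,
  `…_threeBaseCell_pi` (`(π, πℓ₂, πℓ₃, πℓ₅)`, k = 3); THE MEMBERS `zW = ![1, ℓ₂, ℓ₃]`, `zWpi = ![π, πℓ₂, πℓ₃]`: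
  (i) `linearIndependent_zW/zWpi`, (ii) `linLiouville_zW/zWpi`, (iii) `not_hyperLinLiouville_zW/zWpi` — ALL
  HYPOTHESIS-FREE (`zW_in_scope_33364`, `zWpi_in_scope_33364`); (iv) `sb_zW (hNW)`, `sb_zWpi` (NO hypothesis);
  `finiteOrderLiouvilleSchanuel_at_zW (hNW)` / `_at_zWpi`; SEPARATION `zW_coordinates_below_previous_classes`
  (`¬ LogLogLiouville ℓ₃ ∧ ¬ LogSqLiouville ℓ₃ ∧ ¬ LogHyperLiouville ℓ₃ ∧ ¬ HyperLiouville ℓ₃ ∧ ¬ LogLogLiouville ℓ₂`,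
  tree classes BY NAME) and `zW_outside_logLogCells` (`z_W`, `z_W^π` lie on NO g35 cell
  `Set.range z = Set.range ![1, ℓ₂, ρ]` / `![π, πℓ₂, πρ]` with `ρ` log-log-Liouville — hence on no g34 / hyper cell).
Two tree-PRIVATE helpers of Cell08 are re-proved locally and attributed (`sb_of_range_eq'`,
`linearIndependent_of_int_forms'`); nothing else is copied.

## The ladder (the lens; texts)
33364's scope over a Liouville prefix was graded so far along ONE axis — the TYPE of one extra datum `ρ` over
`(1, ℓ₂)` (g34: log-hyper; g35: log-square ⊂ log-log = the one-coordinate engine's reach).  This node opens the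
second axis — the NUMBER `k` of expansion-pinned Liouville coordinates with independent bases — and DECIDES it for
every `k` (mod NWMeasure with `e`; hypothesis-free with `π`).  OPEN above this node: (α) Liouville coordinates given
by ORDER DATA only (Mathlib `Liouville ρ`; §3 needs the lacunary skeleton — K-R19 (α), control C3); multiplicatively
DEPENDENT bases (`(2, 4)`: `weights_b24_not_injective`; the cell `(1, ℓ₂, ℓ₄)` is not covered here);
`(ℓ₂, ℓ₂²)` (Generic21 `liouvilleNumber_sq_open_cell_status`).  Ceiling recorded, not attacked.
-/

noncomputable section

open Complex IntermediateField Polynomial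
open Summit.Schanuel.Schanuel.Theorems.RootDecomp1KHyper
open Summit.Schanuel.Schanuel.Theorems.RootDecomp1KHyper.HyperCell
open Summit.Schanuel.Schanuel.Theorems.RootDecomp1KGeneric
open Summit.Schanuel.Schanuel.Theorems.RootDecomp1KRelLiouvilleCell
open Summit.Schanuel.Schanuel.Theorems.RootDecomp1KLogLogCell (LogLogLiouville logLogLiouville_of_logSqLiouville
  logLogLiouville_of_logHyperLiouville logLogLiouville_of_hyperLiouville)

namespace Summit.Schanuel.Schanuel.Theorems.RootDecomp1KTwoBaseCell

/-! ## §1  Tails of Liouville numbers in base `m ≥ 2` -/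

section Tails
open LiouvilleNumber
open scoped Nat

/-- The tail recursion `r_k = m^{-(k+1)!} + r_{k+1}`. -/
private theorem remainder_eq_succ {m : ℝ} (hm : 1 < m) (k : ℕ) :
    remainder m k = 1 / m ^ (k + 1)! + remainder m (k + 1) := by
  have h1 := partialSum_add_remainder hm k
  have h2 := partialSum_add_remainder hm (k + 1)
  rw [partialSum_succ] at h2
  linarith

/-- Lower bound for the tail: its first term, `m^{-(k+1)!} ≤ r_k`. -/
private theorem remainder_ge {m : ℝ} (hm : 1 < m) (k : ℕ) : 1 / m ^ (k + 1)! ≤ remainder m k := by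
  rw [remainder_eq_succ hm k]
  linarith [remainder_pos hm (k + 1)]

/-- Upper bound for the tail in base `m ≥ 2`: `r_k ≤ 2·m^{-(k+1)!}`. -/
private theorem remainder_le {m : ℝ} (hm : 2 ≤ m) (k : ℕ) : remainder m k ≤ 2 / m ^ (k + 1)! := by
  have m1 : (1 : ℝ) < m := by linarith
  have m0 : (0 : ℝ) < m := by linarith
  have h := remainder_lt' k m1
  have hhalf : (1 : ℝ) / m ≤ 1 / 2 := one_div_le_one_div_of_le two_pos hm
  have hpos : (0 : ℝ) < 1 - 1 / m := by linarith
  have hinv : (1 - 1 / m)⁻¹ ≤ 2 := by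
    rw [inv_le_comm₀ hpos two_pos]
    linarith
  have hmk : (0 : ℝ) < 1 / m ^ (k + 1)! := by positivity
  calc remainder m k ≤ (1 - 1 / m)⁻¹ * (1 / m ^ (k + 1)!) := h.le
    _ ≤ 2 * (1 / m ^ (k + 1)!) := mul_le_mul_of_nonneg_right hinv hmk.le
    _ = 2 / m ^ (k + 1)! := by ring

/-- The partial sums are positive. -/
theorem partialSum_pos' {m : ℝ} (hm : 0 < m) (k : ℕ) : 0 < partialSum m k := by
  unfold partialSum
  exact Finset.sum_pos (fun i _ => by positivity) ⟨0, by simp⟩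

/-- `ℓ_m ≤ 3/2 < 2` for `m ≥ 2`. -/
theorem liouvilleNumber_le {m : ℝ} (hm : 2 ≤ m) : liouvilleNumber m ≤ 3 / 2 := by
  have m1 : (1 : ℝ) < m := by linarith
  have m0 : (0 : ℝ) < m := by linarith
  rw [← partialSum_add_remainder m1 0]
  have h0 : partialSum m 0 = 1 / m := by simp [partialSum]
  have h1 : remainder m 0 ≤ 2 / m ^ (0 + 1)! := remainder_le hm 0
  have h2 : (2 : ℝ) / m ^ (0 + 1)! = 2 / m := by simp
  have h3 : (1 : ℝ) / m ≤ 1 / 2 := one_div_le_one_div_of_le two_pos hm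
  have h4 : (2 : ℝ) / m ≤ 1 := by rw [div_le_one m0]; exact hm
  rw [h0]; linarith

/-- `0 < s_{N} < ℓ_m ≤ 3/2`: the partial sums lie in `(0, 2)`. -/
theorem partialSum_lt_two {m : ℝ} (hm : 2 ≤ m) (k : ℕ) : partialSum m k < 2 := by
  have m1 : (1 : ℝ) < m := by linarith
  have := partialSum_add_remainder m1 k
  linarith [remainder_pos m1 k, liouvilleNumber_le hm]

/-- The numerator of `s_N = p / m^{N!}` is `< 2·m^{N!}`. -/
theorem numerator_lt {m : ℕ} (hm : 2 ≤ m) {N p : ℕ} (hp : partialSum (m : ℝ) N = p / ((m ^ N ! : ℕ) : ℝ)) :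
    p < 2 * m ^ N ! := by
  have hmR : (2 : ℝ) ≤ m := by exact_mod_cast hm
  have hlt := partialSum_lt_two hmR N
  rw [hp] at hlt
  have hpos : (0 : ℝ) < ((m ^ N ! : ℕ) : ℝ) := by positivity
  rw [div_lt_iff₀ hpos] at hlt
  exact_mod_cast hlt

end Tails

/-! ## §2  Monomial weights `∏ b_i^{m_i}`; injectivity for the bases `(2, 3)` and for pairwise-coprime bases -/

section Weights

variable {k : ℕ}

/-- The weight of the monomial `Y^m` for the bases `b`: `wt b m = ∏ b_i^{m_i}`. -/
def wt (b : Fin k → ℕ) (m : Fin k →₀ ℕ) : ℕ := ∏ i, b i ^ m i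

/-- Monomial weights are positive for bases `≥ 2`. -/
theorem wt_pos {b : Fin k → ℕ} (hb : ∀ i, 2 ≤ b i) (m : Fin k →₀ ℕ) : 0 < wt b m :=
  Finset.prod_pos fun i _ => pow_pos (by have := hb i; omega) _

/-- Monomial weights are at least `1` for bases `≥ 2`. -/
theorem one_le_wt {b : Fin k → ℕ} (hb : ∀ i, 2 ≤ b i) (m : Fin k →₀ ℕ) : 1 ≤ wt b m := wt_pos hb m

/-- `(wt b m : ℝ) = ∏ (b_i : ℝ)^{m_i}`. -/
theorem wt_cast (b : Fin k → ℕ) (m : Fin k →₀ ℕ) : (wt b m : ℝ) = ∏ i, (b i : ℝ) ^ m i := by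
  unfold wt; push_cast; rfl

/-- **Pairwise-coprime bases have injective weights** (unique factorisation, in the elementary form
`b_i^{m_i} ∣ ∏_j b_j^{m'_j}`, `gcd(b_i, b_j) = 1 (j ≠ i)` ⇒ `b_i^{m_i} ∣ b_i^{m'_i}` ⇒ `m_i ≤ m'_i`). -/
theorem wt_injective_of_pairwise_coprime {b : Fin k → ℕ} (hb : ∀ i, 2 ≤ b i)
    (hcop : ∀ i j, i ≠ j → Nat.Coprime (b i) (b j)) : Function.Injective (wt b) := by
  classical
  -- one inequality suffices, by symmetry
  have key : ∀ m m' : Fin k →₀ ℕ, wt b m = wt b m' → ∀ i, m i ≤ m' i := by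
    intro m m' h i
    have hdvd : b i ^ m i ∣ wt b m' := by
      rw [← h]; exact Finset.dvd_prod_of_mem _ (Finset.mem_univ i)
    unfold wt at hdvd
    rw [← Finset.mul_prod_erase _ _ (Finset.mem_univ i)] at hdvd
    have hcop' : Nat.Coprime (b i ^ m i) (∏ j ∈ Finset.univ.erase i, b j ^ m' j) := by
      refine Nat.Coprime.prod_right fun j hj => ?_
      exact Nat.Coprime.pow _ _ (hcop i j (Finset.ne_of_mem_erase hj).symm)
    have hdvd' : b i ^ m i ∣ b i ^ m' i := hcop'.dvd_of_dvd_mul_right hdvd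
    exact (Nat.pow_dvd_pow_iff_le_right (by have := hb i; omega)).mp hdvd'
  intro m m' h
  ext i
  exact le_antisymm (key m m' h i) (key m' m h.symm i)

/-- The bases `(2, 3)`. -/
def b23 : Fin 2 → ℕ := ![2, 3]

/-- The bases `(2, 3)` are `≥ 2`. -/
theorem two_le_b23 : ∀ i, 2 ≤ b23 i := by
  intro i; fin_cases i <;> simp [b23]

/-- The bases `(2, 3)` are pairwise coprime. -/
theorem b23_pairwise_coprime : ∀ i j : Fin 2, i ≠ j → Nat.Coprime (b23 i) (b23 j) := by
  decide

/-- **Unique factorisation for `2^a 3^b`:** the weights of the bases `(2, 3)` are injective. -/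
theorem wt_b23_injective : Function.Injective (wt b23) :=
  wt_injective_of_pairwise_coprime two_le_b23 b23_pairwise_coprime

end Weights

end Summit.Schanuel.Schanuel.Theorems.RootDecomp1KTwoBaseCell
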